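import Mathlib
import HarnessLib
import Summits.ResolutionOfSingularities.ResolutionOfSingularities.Theorems.WildQuotientsWildQuotientResolutionS1aKillFree
import Summits.ResolutionOfSingularities.ResolutionOfSingularities.Theorems.WildQuotientsWildQuotientResolutionS1aNpFrame

/-!
# S1a — THE K-FREE FRAME OF RECORD (R-F14/R-F14a): decorated models, the carried formal locus `F_𝔄`, bounded trees lowering `μ_F` WIN

[OURS · L1 W4.5c · lead-1 g11; plan-1 RULINGS R-F14 «K-free frame: named immediate kills + carried-atlas measure» / R-F14a (the registered stub is the
carried-atlas twin `ReachLowerInF` of `ReachLowerIn`), CHAIN v10.33] — NOT statements of the manuscript; counted 0; AI-level work, weaker than expert review. Crux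
stmt-ResolutionOfSingularities-17941 `CyclicQuotientFourfolds`, line `s1a-logminvertex` v12. Route-independent.

A DECORATED model is a model `M` with atlas DATA `𝔄` (any family of node-data charts covering `M.V`; no compatibility). Its measure is
`μ_F = lex (dim F_𝔄, nTopComp F_𝔄, nIrrComp F_𝔄)` where `F_𝔄 = {u | no chart of 𝔄 is principal near u}` ⊇ `Z(M)` (`…S1aNpFrame`). Why `F` and not the typed
`Z` (R-F14a): a progress certificate «the aux support contains a top component of the LOCUS» must be of the provable kind — for `F_𝔄` it is the producer's OWN
non-principality (`not_isPrincipal_map_augmentationIdeal_atPrime`, `…S1aKillTightRing`); for `Z` it would be a badness lower bound (ADD-BAD).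

* `NodeAtlasData.fdim / ftop / fcomp`, `LexLTF` — the measure and its lexicographic order on decorated models;
* `TreeF P Q n M 𝔄` — strategy trees on decorated models: leaves (`Q`), REFINEMENT nodes (same model, new atlas in `P`), MOVE nodes (admissible centre; for
  every realisation `M′` SOME atlas `𝔄′` with `(M′, 𝔄′) ∈ P`); `TreeF.mono`, `wins_of_treeF`;
* ★★ `wins_of_reachLowerF` — the triple induction, GENERIC in the measure (any `m₁ : … → WithBot ℕ∞`, `m₂ m₃ : … → ℕ` with `m₁` bounded on `P`); instantiated:
  ★★ `wins_of_reachLowerInF`;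
* research def `ReachLowerInF p` (OURS CANDIDATE, asserted nowhere; binders VERBATIM those of `AuxWithinIn`; initial decoration = `NodeAtlasData.ofNodeAtlas h₀`, the plain atlas):
  ∃ class `P ∋ (initial, plain atlas)` such that from every non-terminal decorated `P`-model a bounded `TreeF` inside `P` reaches `μ_F`-lower decorated models;
* ★ `winningStrategy_of_reachLowerInF : ReachLowerInF p → WinningStrategy p`, `cyclicQuotientFourfolds_of_door_of_reachLowerInF` (skeleton v12 composition).
The kernel uses ONLY well-foundedness; `badLocus ⊆ F_𝔄`, `F_𝔄 = ∅ ⇒ Terminal`, (T1)–(T3), K-EXO/K-U/NORMALISE/TightRing are the PRODUCER's tools for building trees.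
-/

set_option linter.dupNamespace false

noncomputable section

open CategoryTheory Limits AlgebraicGeometry TopologicalSpace Topology
open Literature.AlgebraicGeometry.Resolution Literature.AlgebraicGeometry.RelativeSpec
open Summit.ResolutionOfSingularities.ResolutionOfSingularities.Theorems.WildQuotientResolution.S1
open Summit.ResolutionOfSingularities.ResolutionOfSingularities.Theorems.WildQuotientResolution.S1.NodeAtlas
open Summit.ResolutionOfSingularities.ResolutionOfSingularities.Theorems.WildQuotientResolution.S1.CompCount
open Summit.ResolutionOfSingularities.ResolutionOfSingularities.Theorems.WildQuotientResolution.S1.NpFrame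

namespace Summit.ResolutionOfSingularities.ResolutionOfSingularities.Theorems.WildQuotientResolution.S1

namespace GameFrame.GModel

variable {p : ℕ} {X' X₁ : Scheme.{0}} {q : X' ⟶ X₁} {G : Type} [Group G] {ρ : G →* Aut X'} {g₀ : G}

/-! ## The measure of a decorated model -/

/-- Dimension of the carried formal locus. [OURS · L1 W4.5c · R-F14] -/
def fdim (M : GModel p q G ρ g₀) (𝔄 : NodeAtlasData p M.act g₀) : WithBot ℕ∞ := topologicalKrullDim ↥𝔄.fLocus

/-- Number of top-dimensional components of the carried formal locus. [OURS · L1 W4.5c · R-F14] -/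
def ftop (M : GModel p q G ρ g₀) (𝔄 : NodeAtlasData p M.act g₀) : ℕ := TopCount.nTopComp ↥𝔄.fLocus

/-- Number of irreducible components of the carried formal locus. [OURS · L1 W4.5c · R-F14] -/
def fcomp (M : GModel p q G ρ g₀) (𝔄 : NodeAtlasData p M.act g₀) : ℕ := nIrrComp ↥𝔄.fLocus

/-- `dim F_𝔄 ≤ dim V`. -/
theorem fdim_le (M : GModel p q G ρ g₀) (𝔄 : NodeAtlasData p M.act g₀) : M.fdim 𝔄 ≤ topologicalKrullDim M.V :=
  IsInducing.subtypeVal.topologicalKrullDim_le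

/-- `dim F_𝔄` is bounded for models of a datum. -/
theorem exists_nat_fdim_lt_of_datum {k : Type} [Field k] (f : X₁ ⟶ Spec (.of k)) [LocallyOfFiniteType f] [QuasiCompact f] [IsFinite q]
    (M : GModel p q G ρ g₀) (𝔄 : NodeAtlasData p M.act g₀) : ∃ n : ℕ, M.fdim 𝔄 < n := by
  haveI := M.isProper
  have hr : M.r = M.π ≫ q := M.r_eq
  haveI : LocallyOfFiniteType (M.r ≫ f) := by rw [hr]; infer_instance
  haveI : QuasiCompact (M.r ≫ f) := by rw [hr]; infer_instance
  haveI : CompactSpace M.V := (HasAffineProperty.iff_of_isAffine (P := @QuasiCompact)).mp ‹QuasiCompact (M.r ≫ f)›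
  obtain ⟨n, hn⟩ := exists_topologicalKrullDim_le_of_locallyOfFiniteType (M.r ≫ f)
  exact ⟨n + 1, lt_of_le_of_lt ((M.fdim_le 𝔄).trans hn) (by exact_mod_cast Nat.lt_succ_self n)⟩

/-- **The lexicographic order on `(m₁, m₂, m₃)`** for a generic measure on decorated models. -/
def LexLT3 (m₁ : ∀ M : GModel p q G ρ g₀, NodeAtlasData p M.act g₀ → WithBot ℕ∞)
    (m₂ m₃ : ∀ M : GModel p q G ρ g₀, NodeAtlasData p M.act g₀ → ℕ)
    (N : GModel p q G ρ g₀) (𝔅 : NodeAtlasData p N.act g₀) (M : GModel p q G ρ g₀) (𝔄 : NodeAtlasData p M.act g₀) : Prop :=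
  m₁ N 𝔅 < m₁ M 𝔄 ∨ (m₁ N 𝔅 = m₁ M 𝔄 ∧ (m₂ N 𝔅 < m₂ M 𝔄 ∨ (m₂ N 𝔅 = m₂ M 𝔄 ∧ m₃ N 𝔅 < m₃ M 𝔄)))

/-- **`μ_F`-order**: the lexicographic order on `(dim F_𝔄, nTopComp F_𝔄, nIrrComp F_𝔄)`. [OURS · L1 W4.5c · R-F14] -/
def LexLTF (N : GModel p q G ρ g₀) (𝔅 : NodeAtlasData p N.act g₀) (M : GModel p q G ρ g₀) (𝔄 : NodeAtlasData p M.act g₀) : Prop :=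
  LexLT3 fdim ftop fcomp N 𝔅 M 𝔄

/-! ## Trees on decorated models -/

/-- **Strategy tree of depth `≤ n` on DECORATED models** inside the class `P` with leaves in `Q`: a leaf; or a REFINEMENT node (same model, another atlas in
`P`, one level down); or a MOVE node (an admissible centre; for EVERY realisation `M′` SOME atlas `𝔄′` with `(M′, 𝔄′) ∈ P`, one level down).
[OURS · L1 W4.5c · R-F14] -/
def TreeF (P Q : ∀ M : GModel p q G ρ g₀, NodeAtlasData p M.act g₀ → Prop) : ℕ → ∀ M : GModel p q G ρ g₀, NodeAtlasData p M.act g₀ → Prop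
  | 0, M, 𝔄 => Q M 𝔄
  | n + 1, M, 𝔄 => Q M 𝔄 ∨ (∃ 𝔄' : NodeAtlasData p M.act g₀, P M 𝔄' ∧ TreeF P Q n M 𝔄') ∨
      ∃ (𝒦 : ReesFiltration M.V) (d : ℕ), IsAdmissibleCentre p M.act g₀ 𝒦 d ∧
        ∀ M' : GModel p q G ρ g₀, M.IsMoveOf M' 𝒦 d → ∃ 𝔄' : NodeAtlasData p M'.act g₀, P M' 𝔄' ∧ TreeF P Q n M' 𝔄'

/-- Deeper trees contain shallower ones. -/
theorem TreeF.mono {P Q : ∀ M : GModel p q G ρ g₀, NodeAtlasData p M.act g₀ → Prop} :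
    ∀ {n m : ℕ} (M : GModel p q G ρ g₀) (𝔄 : NodeAtlasData p M.act g₀), n ≤ m → TreeF P Q n M 𝔄 → TreeF P Q m M 𝔄
  | 0, 0, _, _, _, h => h
  | 0, _ + 1, _, _, _, h => Or.inl h
  | _ + 1, 0, _, _, hnm, _ => absurd hnm (Nat.not_succ_le_zero _)
  | n + 1, m + 1, M, 𝔄, hnm, h => by
      rcases h with h | ⟨𝔄', hP, ht⟩ | ⟨𝒦, d, hadm, hmv⟩
      · exact Or.inl h
      · exact Or.inr (Or.inl ⟨𝔄', hP, TreeF.mono M 𝔄' (Nat.succ_le_succ_iff.mp hnm) ht⟩)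
      · refine Or.inr (Or.inr ⟨𝒦, d, hadm, fun M' hm => ?_⟩)
        obtain ⟨𝔄', hP, ht⟩ := hmv M' hm
        exact ⟨𝔄', hP, TreeF.mono M' 𝔄' (Nat.succ_le_succ_iff.mp hnm) ht⟩

/-- **A tree whose leaves win makes its root win.** [OURS · L1 W4.5c · R-F14] -/
theorem wins_of_treeF {P Q : ∀ M : GModel p q G ρ g₀, NodeAtlasData p M.act g₀ → Prop}
    (hQ : ∀ (N : GModel p q G ρ g₀) (𝔅 : NodeAtlasData p N.act g₀), P N 𝔅 → Q N 𝔅 → Wins p q G ρ g₀ N) :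
    ∀ (n : ℕ) (M : GModel p q G ρ g₀) (𝔄 : NodeAtlasData p M.act g₀), P M 𝔄 → TreeF P Q n M 𝔄 → Wins p q G ρ g₀ M
  | 0, M, 𝔄, hPM, h => hQ M 𝔄 hPM h
  | n + 1, M, 𝔄, hPM, h => by
      rcases h with h | ⟨𝔄', hP, ht⟩ | ⟨𝒦, d, hadm, hmv⟩
      · exact hQ M 𝔄 hPM h
      · exact wins_of_treeF hQ n M 𝔄' hP ht
      · refine Wins.of_moves 𝒦 d hadm fun M' hm => ?_
        obtain ⟨𝔄', hP, ht⟩ := hmv M' hm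
        exact wins_of_treeF hQ n M' 𝔄' hP ht

/-! ## The winning induction, generic in the measure -/

/-- ★★ **BOUNDED TREES REACHING LOWER MEASURE WIN — generic measure.** For any measure `(m₁, m₂, m₃)` on decorated models with `m₁` bounded on `P`: if from
every non-terminal decorated `P`-model some bounded tree inside `P` reaches decorated models of lower `lex (m₁, m₂, m₃)`, then every decorated `P`-model wins.
Only well-foundedness is used. [OURS · L1 W4.5c · R-F14] -/
theorem wins_of_reachLowerF (m₁ : ∀ M : GModel p q G ρ g₀, NodeAtlasData p M.act g₀ → WithBot ℕ∞)
    (m₂ m₃ : ∀ M : GModel p q G ρ g₀, NodeAtlasData p M.act g₀ → ℕ)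
    (P : ∀ M : GModel p q G ρ g₀, NodeAtlasData p M.act g₀ → Prop)
    (hbd : ∀ (M : GModel p q G ρ g₀) (𝔄 : NodeAtlasData p M.act g₀), P M 𝔄 → ∃ n : ℕ, m₁ M 𝔄 < n)
    (H : ∀ (M : GModel p q G ρ g₀) (𝔄 : NodeAtlasData p M.act g₀), P M 𝔄 → ¬ M.Terminal →
      ∃ n : ℕ, TreeF P (fun N 𝔅 => LexLT3 m₁ m₂ m₃ N 𝔅 M 𝔄) n M 𝔄)
    (M₀ : GModel p q G ρ g₀) (𝔄₀ : NodeAtlasData p M₀.act g₀) (hP₀ : P M₀ 𝔄₀) : Wins p q G ρ g₀ M₀ := by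
  obtain ⟨n₀, hn₀⟩ := hbd M₀ 𝔄₀ hP₀
  suffices main : ∀ (a : ℕ) (M : GModel p q G ρ g₀) (𝔄 : NodeAtlasData p M.act g₀), P M 𝔄 → m₁ M 𝔄 < a → Wins p q G ρ g₀ M from
    main n₀ M₀ 𝔄₀ hP₀ hn₀
  intro a
  induction a using Nat.strong_induction_on with
  | _ a iha =>
    have drop : ∀ (M : GModel p q G ρ g₀) (𝔄 : NodeAtlasData p M.act g₀) (N : GModel p q G ρ g₀) (𝔅 : NodeAtlasData p N.act g₀),
        P N 𝔅 → m₁ M 𝔄 < a → m₁ N 𝔅 < m₁ M 𝔄 → Wins p q G ρ g₀ N := fun M 𝔄 N 𝔅 hPN ha hj => by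
      cases a with
      | zero => exact absurd (withBot_eq_bot_of_lt_zero ha ▸ hj) not_lt_bot
      | succ a' => exact iha a' (Nat.lt_succ_self a') N 𝔅 hPN (lt_of_lt_of_le hj (withBot_le_of_lt_succ ha))
    have level : ∀ (b c : ℕ) (M : GModel p q G ρ g₀) (𝔄 : NodeAtlasData p M.act g₀), P M 𝔄 → m₁ M 𝔄 < a → m₂ M 𝔄 < b → m₃ M 𝔄 < c →
        Wins p q G ρ g₀ M := by
      intro b
      induction b with
      | zero => exact fun c M 𝔄 _ _ hb _ => absurd hb (Nat.not_lt_zero _)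
      | succ b ihb =>
        intro c
        induction c with
        | zero => exact fun M 𝔄 _ _ _ hc => absurd hc (Nat.not_lt_zero _)
        | succ c ihc =>
          intro M 𝔄 hPM ha hb hc
          by_cases hT : M.Terminal
          · exact Wins.terminal M hT
          obtain ⟨n, htree⟩ := H M 𝔄 hPM hT
          refine wins_of_treeF (fun N 𝔅 hPN hlex => ?_) n M 𝔄 hPM htree
          rcases hlex with hlt | ⟨heq, hlt | ⟨heq', hlt'⟩⟩
          · exact drop M 𝔄 N 𝔅 hPN ha hlt
          · exact ihb (m₃ N 𝔅 + 1) N 𝔅 hPN (heq ▸ ha) (lt_of_lt_of_le hlt (Nat.lt_succ_iff.mp hb)) (Nat.lt_succ_self _)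
          · exact ihc N 𝔅 hPN (heq ▸ ha) (heq' ▸ hb) (lt_of_lt_of_le hlt' (Nat.lt_succ_iff.mp hc))
    intro M 𝔄 hPM ha
    exact level (m₂ M 𝔄 + 1) (m₃ M 𝔄 + 1) M 𝔄 hPM ha (Nat.lt_succ_self _) (Nat.lt_succ_self _)

/-- ★★ **BOUNDED TREES REACHING `μ_F`-LOWER DECORATED MODELS WIN.** [OURS · L1 W4.5c · R-F14] -/
theorem wins_of_reachLowerInF (P : ∀ M : GModel p q G ρ g₀, NodeAtlasData p M.act g₀ → Prop)
    (hbd : ∀ (M : GModel p q G ρ g₀) (𝔄 : NodeAtlasData p M.act g₀), P M 𝔄 → ∃ n : ℕ, M.fdim 𝔄 < n)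
    (H : ∀ (M : GModel p q G ρ g₀) (𝔄 : NodeAtlasData p M.act g₀), P M 𝔄 → ¬ M.Terminal →
      ∃ n : ℕ, TreeF P (fun N 𝔅 => LexLTF N 𝔅 M 𝔄) n M 𝔄)
    (M₀ : GModel p q G ρ g₀) (𝔄₀ : NodeAtlasData p M₀.act g₀) (hP₀ : P M₀ 𝔄₀) : Wins p q G ρ g₀ M₀ :=
  wins_of_reachLowerF fdim ftop fcomp P hbd H M₀ 𝔄₀ hP₀

end GameFrame.GModel

/-! ## The research statement of record and the skeleton-v12 derivations -/

/-- **`ReachLowerInF p`** (OURS CANDIDATE research statement — the ONE research stub of skeleton v12 —, asserted nowhere; binders VERBATIM those of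
`AuxWithinIn`): for every datum of the crux there is a class `P` of DECORATED models (model + atlas data, no compatibility) containing the initial model with
its plain atlas (`NodeAtlasData.ofNodeAtlas h₀`) such that from every non-terminal decorated `P`-model some BOUNDED STRATEGY TREE inside `P` (refinement nodes,
move nodes along admissible centres with a `P`-decoration of every realisation) reaches decorated models of lexicographically lower
`μ_F = (dim F_𝔄, nTopComp F_𝔄, nIrrComp F_𝔄)`. Intended witnesses: (KN) a NAMED principal centre meeting `F_𝔄` (kills executed at once), (AK) an aux centre whose
support contains a top component of `F_𝔄` followed by ≤ k nested named kills clearing the formal points over its support, (R) atlas refinements deleting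
multiplicative points (Laurent charts). [OURS · L1 W4.5c · R-F14/R-F14a] -/
def ReachLowerInF (p : ℕ) : Prop :=
  ∀ (k : Type) [Field k] [CharP k p] [PerfectField k] (X' X₁ : Scheme.{0})
    (f : X₁ ⟶ Spec (.of k)) (q : X' ⟶ X₁) (G : Type) [Group G] [Finite G]
    (ρ : G →* Aut X'), Nat.card G = p → IsSeparated f → LocallyOfFiniteType f → QuasiCompact f →
    IsIntegral X₁ → ∀ [IsIntegral X'], Scheme.IsRegular X' → IsFinite q → Function.Surjective q.base →
    (∃ U : X₁.Opens, Dense (U : Set X₁) ∧ Etale (q ∣_ U)) →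
    ∀ (hq : ∀ g : G, (ρ g).hom ≫ q = q),
    (∀ x y : X', q.base x = q.base y → ∃ g : G, (ρ g).hom.base x = y) →
    topologicalKrullDim X₁ ≤ 4 → Function.Injective ρ →
    ∀ (g₀ : G), (∀ g : G, g ∈ Subgroup.zpowers g₀) → ∀ [IsLocallyNoetherian X']
      (h₀ : NodeAtlas p (⟨ρ, hq⟩ : ActionOver q G) g₀),
      ∃ P : ∀ M : GameFrame.GModel p q G ρ g₀, NodeAtlasData p M.act g₀ → Prop,
        P (GameFrame.GModel.initial hq h₀) (NodeAtlasData.ofNodeAtlas (p := p) (ρ := (⟨ρ, hq⟩ : ActionOver q G)) (g₀ := g₀) h₀) ∧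
        ∀ (M : GameFrame.GModel p q G ρ g₀) (𝔄 : NodeAtlasData p M.act g₀), P M 𝔄 → ¬ M.Terminal →
          ∃ n : ℕ, GameFrame.GModel.TreeF P (fun N 𝔅 => GameFrame.GModel.LexLTF N 𝔅 M 𝔄) n M 𝔄

/-- ★ **`ReachLowerInF p ⇒ WinningStrategy p`.** [OURS · L1 W4.5c · R-F14] -/
theorem winningStrategy_of_reachLowerInF {p : ℕ} (h : ReachLowerInF p) : FrameWins.WinningStrategy p := by
  intro k _ _ _ X' X₁ f q G _ _ ρ hG hfs hfft hfqc hX₁ _ hreg hqfin hqs hqet hq horb hdim hinj g₀ hg₀ _ h₀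
  haveI := hfft
  haveI := hfqc
  haveI := hqfin
  obtain ⟨P, hP₀, H⟩ := h k X' X₁ f q G ρ hG hfs hfft hfqc hX₁ hreg hqfin hqs hqet hq horb hdim hinj g₀ hg₀ h₀
  exact GameFrame.GModel.wins_of_reachLowerInF P (fun M 𝔄 _ => GameFrame.GModel.exists_nat_fdim_lt_of_datum f M 𝔄) H _ _ hP₀

/-- **Door + `ReachLowerInF` ⇒ the sub-crux `CyclicQuotientFourfolds`** (skeleton v12 composition pattern). [OURS · L1 W4.5c · R-F14] -/
theorem cyclicQuotientFourfolds_of_door_of_reachLowerInF (hD : FrameWins.DoorStatement) (h : ∀ p : ℕ, p.Prime → ReachLowerInF p) :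
    Summit.ResolutionOfSingularities.ResolutionOfSingularities.Theses.WildQuotients.CyclicQuotientFourfolds :=
  FrameWins.cyclicQuotientFourfolds_of_door_of_wins hD fun p hp _ => winningStrategy_of_reachLowerInF (h p hp)

end Summit.ResolutionOfSingularities.ResolutionOfSingularities.Theorems.WildQuotientResolution.S1

end
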